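import Summits.QuantumFields.YangMills.Theorems.BalabanUVNodesN09AtRecord13SepCoPHLoc
import Summits.QuantumFields.YangMills.Theorems.BalabanUVNodesN09AtRecord13SepCoPHFluctNesting

/-!
# BalabanUVNodes ∕ N09 at the STAGE-13 v1.7 `SepCoPH` record — the NESTING binder of the Theorem-3 member is a CONSEQUENCE of the localised SUPPORT
# binder, gauge-stability of the bookkeeping sets and [B11]'s one-orbit clause: NO hereditary selection, NO axial convention
# ([Balaban1987RG1] (2.1)–(2.3) p. 265, (2.9) p. 266; [Balaban1985Variational] Thm 1 p. 279)

TRACK A (YM-PLAN §2b, node N09 of 28 = [B12] = [Balaban1987RG1] (CMP 109) Thm 3 p. 264 + Lemma 4 p. 280), WIDTH SEAT `pub-ymgap-dag-n09-w3` (g2; HUMAN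
RULING D-0149, director-ym №197).  Key of record it serves: K1⁷ `StabilityBAtRecordR13SepCoPH` = stmt-QuantumFields-20542 (`--supports`, count-neutral
helper).  A NEW importing module over dag-n09-w2's localised junction `…N09AtRecord13SepCoPHLoc` (p591459) and this seat's g0 FILE 1 `…N09AtRecord13SepCoPHFluctNesting`
(p583971); THEOREMS ONLY, def-free, sorry-free, standard axioms.  [I] = [Balaban1987RG1], [B11] = [Balaban1985Variational], [B7] = [Balaban1985Averaging].

WHY.  Every located door for N09's Theorem-3 member at the Stage-13 record (dag-n24-c's junction p572963 and its 17H ∕ 20H ∕ 24H editions, dag-n09-w2's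
`thm3Member_stage13SepCoPH_of_stepsOnLoc`, this seat's `…OnDomains`, dag-n09-w1 ∕ w2 g2's re-keyings) displays the NESTING binder
`hnest : ∀ k ≤ K, ∀ V ∈ domAlt_k, ∀ j < k, Ū^j(U_k V) ∈ D j` («the averaged backgrounds sit in the bookkeeping sets»; 24H's `h09nest`).  g0 FILE 1 reduced it to the
support binder (F7a) plus ONE selection clause, HERED «`V^{(j)}(Ū^{j+1}(U_k V)) = Ū^j(U_k V)`», NOT derivable for the record's bare-choice `Uk` and priced by every
sibling seat as a property of a RE-POINTED selection (dag-n09-w1 g2: HERED modulo a fine transformation, exact under block-axiality of both sides; dag-n09-w4 g2: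
the rooted selector `UkSel` is not nested across levels).  THIS FILE removes HERED from the list altogether.  Two observations, both at the BARE-CHOICE record:
* «at the background the fluctuation field vanishes» ([I] (2.1)–(2.3) p. 265) holds EXACTLY at the critical configuration `V^{(j)}(W′) = M^j(U_{j+1}(W′))` ITSELF,
  for EVERY solvable `W′` and ANY selection: `M(V^{(j)}(W′)) = W′` (K0e `avg_critCfgOfRecord`), so the fluctuation variable of (2.9) at `V := V^{(j)}(W′)` is
  `V^{(j)}(V̄)⁻¹·V = 1` and `χ^{(2.9)}_j(V^{(j)}(W′)) = 1` (g0 §1 `chiFix29OfRecord_eq_one_of_critCfg_eq`);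
* for `W′ := Ū^{j+1}(U_k V)`, [B11]'s one-orbit clause («`U_{j+1}(W′)` lies in the residual orbit of `U_k V`», node00-def-B's `HOrbit` shape, here with the two
  radii of record: `U_k` at `θ.εbg`, `U_{j+1}` at `θ.ν.εreg`) and gauge covariance of the iterated averages (r13 `iter_gaugeAct`, [B7] (11)) make `V^{(j)}(W′)` a
  level-`j` GAUGE IMAGE of `Ū^j(U_k V)`.
Hence, by DOWNWARD INDUCTION on `j` from `Ū^k(U_k V) = V ∈ D k`: `W′ ∈ D (j+1)` (induction hypothesis) ⇒ `W′` solvable (`hDsol`) ⇒ `χ_j(V^{(j)}(W′)) = 1 ≠ 0` with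
`M(V^{(j)}(W′)) = W′ ∈ D (j+1)` ⇒ `V^{(j)}(W′) ∈ D j` (the localised support clause `hχD`) ⇒ `Ū^j(U_k V) ∈ D j` (gauge-stability `hDst`).  So `hnest` follows from the
door's OWN binders `hχD`, `hDst`, `hDsol` plus: the one-orbit clause `horb` ([B11]; at one radius it is the door's own `hres` + `huniq`, node00-def-B
`hOrbit_of_hRestrict_of_unique`; with the two radii of record it is dag-n09-w1 g2's `orbitRel_Uk_UkSucc_iter_of_thm1_εbg_of_reg8`), the TOP-FIELD membership
`htop : V ∈ D k` for `V ∈ domAlt_k` (for the bookkeeping sets of record `D k = regSet_{k−1} ∩ domAlt_k` this is K0e's `domAlt_subset_regSetOfRecord` species — (F7) at the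
top field, the same analytic content as `hreg`∕`hχD`), stability of `D 0` (trivial at `univ`), and the sign `0 < θ.ε₂₉` (17H's own `hε'`).

WHAT THIS FILE PROVES (9 theorems).  §1 at K0e's objects (`ν`∕`θ₀`, `K`, the radius `ε` of `U_k`, `dom`, `D` arbitrary): `critCfgOfRecord_iter_succ_eq_gaugeAct_of_orbitRel`,
`chiβ13_critCfg_eq_one_of_ukExists`, ★ `iterUk_mem_of_suppLoc_of_stable_of_orbitRel` (the induction).  §2 at the ₁₃ record: ★★ `thm3Member_stage13SepCoPH_of_stepsOnLoc_of_orbitRel`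
(dag-n09-w2's door with `hnest` REPLACED by `horb` + `htop` + `hD0st` + `hε`, every other binder VERBATIM), `b12_main_stage13SepCoPH_of_leaf_of_stepsOnLoc_of_orbitRel`,
`thm3Member_forall_stage13SepCoPH_of_stepsOnLoc_of_orbitRel` (the `∀ P` shape 24H consumes run by run).  §3 the one-radius supplier: `horb_of_hRestrict_of_unique_of_εreg_eq`,
★★ `thm3Member_stage13SepCoPH_of_stepsOnLoc_of_εreg_eq` ∕ `b12_main_stage13SepCoPH_of_leaf_of_stepsOnLoc_of_εreg_eq` (at a record with ONE radius `θ.ν.εreg = θ.εbg` the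
nesting binder costs `htop` + `hD0st` + `hε` and NOTHING else — `horb` is then the door's own `hres` + `huniq`).

HONEST FRAMING: count-neutral kernel bookkeeping BY NAME (indicator algebra `dist1 1 = 0`, gauge covariance of iterated averages, set stability); NO estimate of
Bałaban's is proved; the one-orbit clause, the localised support clause, `htop`, (181)ˢᵒˡ `hcov`, (I19), [B11] Thm 1's three binders are DISPLAYED hypotheses, located in
print, none asserted; A6: no inhabitant at the record is claimed (the filing is a REDUCTION between displayed binders; `dom`, `D`, `ε` arbitrary in §1); N09 NOT discharged;
conjunct 1 (Lemma 4, the leaf `b12`) untouched; K0⁷ ∕ K1⁷ NOT closed; counts unmoved (typed 28∕28 · discharged 5∕27); one finite four-torus programme at fixed `ε = L^{−K}` per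
run — R4 closes the conditional rung `BalabanLadder.UV` only; NOT ℝ⁴, NOT infinite volume, NOT OS, NOT a mass gap; the Yang–Mills mass gap (Clay) is NOT proved by any of this.
-/

noncomputable section

namespace Summit.QuantumFields.YangMills.BalabanUVNodes.N09NestingFromSupport

open MeasureTheory Set
open Literature.MathematicalPhysics.QuantumFieldTheory.Balaban1983to89
open Literature.MathematicalPhysics.QuantumFieldTheory.Balaban1983to89.T4Continuum (T4Family)
open Literature.MathematicalPhysics.QuantumFieldTheory.Balaban1983to89.DagBinding (WorldP leavesP)
open Literature.MathematicalPhysics.QuantumFieldTheory.Balaban1983to89.Node00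
open Literature.MathematicalPhysics.QuantumFieldTheory.Balaban1983to89.B12RTGaugeInvariance254 (liftTransf invTransf gaugeAct_inv_gaugeAct)
open Literature.MathematicalPhysics.QuantumFieldTheory.Balaban1983to89.GaugeField (gaugeAct)
open Literature.MathematicalPhysics.QuantumFieldTheory.Balaban1983to89.B12GaugeOrbits021 (OrbitRel IsResidual)
open Literature.MathematicalPhysics.QuantumFieldTheory.Balaban1983to89.B16Sect1Backgrounds (toMS iter_gaugeAct)
open Literature.MathematicalPhysics.QuantumFieldTheory.Balaban1983to89.B12NodeKnitRecord8 (b12_main_of_leaf_of_thm3Member)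
open N09AtRecord13SepCoPHLoc (thm3Member_stage13SepCoPH_of_stepsOnLoc)
open N09AtRecord13SepCoPHFluctNesting (chiFix29OfRecord_eq_one_of_critCfg_eq)
open N09LiftInvariance29AtRecord (succ_le_range_of_lt)

variable {F : T4Family} {N : ℕ} [NeZero N]

/-! ## §1. At K0e's objects: the critical configuration over `Ū^{j+1}U₀` is a gauge image of `Ū^j U₀`; `χ^{(2.9)}` reads `1` at every critical configuration;
the nesting by downward induction -/

/-- **THE CRITICAL CONFIGURATION OVER `Ū^{j+1}(U₀)` IS A LEVEL-`j` GAUGE IMAGE OF `Ū^j(U₀)`**: if the level-`(j+1)` minimiser of record over `Ū^{j+1}(U₀)` (radius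
`ν.εreg`) lies in the residual orbit of `U₀` — `U_{j+1}(Ū^{j+1}U₀) = U₀^u`, [I] (1.1) «exactly one … orbit» ∕ [B11] Thm 1 — then (2.3) gives
`V^{(j)}(Ū^{j+1}U₀) = M^j(U₀^u) = (M^j U₀)^{u↾T^{(j)}}` by gauge covariance of the iterated averages ([B7] (11), r13 `iter_gaugeAct`; standing range `j < K`).
[cite: Balaban1987RG1, (2.3) p.265 and (1.1) p.260; Balaban1985Averaging, (11) p.19] -/
theorem critCfgOfRecord_iter_succ_eq_gaugeAct_of_orbitRel (ν : Stage7Numerics) {K j : ℕ} (hj : j < K) {U₀ : GaugeField (F.P K) 0 (SU N)}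
    (h : OrbitRel (j + 1) U₀ (Uk F N K (j + 1) ν.εreg (Averaging.iter (avOfRecord F N K) (j + 1) U₀))) :
    ∃ u : GaugeTransf (F.P K) 0 (SU N), IsResidual (j + 1) u ∧
      critCfgOfRecord F N ν K j (Averaging.iter (avOfRecord F N K) (j + 1) U₀) =
        gaugeAct (toMS u j) (Averaging.iter (avOfRecord F N K) j U₀) := by
  obtain ⟨u, hu, hEq⟩ := h
  refine ⟨u, hu, ?_⟩
  rw [critCfgOfRecord_def, hEq]
  exact iter_gaugeAct (avOfRecord F N K) u U₀ j (Nat.le_of_succ_le (succ_le_range_of_lt hj))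

/-- **THE STAGE-13 β-SLOT CUT-OFF READS `1` AT EVERY CRITICAL CONFIGURATION** (any selection, bare choice included): for a SOLVABLE level-`(j+1)` field `W′`
(radius `θ₀.ν.εreg`) the critical configuration `V^{(j)}(W′)` lies in the fibre over `W′` (`M(V^{(j)}(W′)) = W′`), so every fluctuation variable of (2.9) at
`V := V^{(j)}(W′)` is `|V^{(j)}(V̄)(b)⁻¹V(b) − 1| = |1 − 1| = 0 < ε₂₉`: `χ^{(2.9)}_j(V^{(j)}(W′)) = 1`. [cite: Balaban1987RG1, (2.1)–(2.3) p.265 and (2.9) p.266] -/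
theorem chiβ13_critCfg_eq_one_of_ukExists (θ₀ : Stage13Params F N) (hε : 0 < θ₀.ε₂₉) (K : ℕ) (g : ℕ → ℝ) (j : ℕ)
    {W : GaugeField (F.P K) (j + 1) (SU N)} (hW : UkExists F N K (j + 1) θ₀.ν.εreg W) :
    chiβOfRecord₁₃ F N θ₀ K g j (critCfgOfRecord F N θ₀.ν K j W) = 1 :=
  have h' : critCfgOfRecord F N θ₀.ν K j ((avOfRecord F N K j).avg (critCfgOfRecord F N θ₀.ν K j W)) =
      critCfgOfRecord F N θ₀.ν K j W := by
    rw [avg_critCfgOfRecord hW]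
  chiFix29OfRecord_eq_one_of_critCfg_eq θ₀.ν hε K j h'

/-- ★ **THE NESTING BINDER BY DOWNWARD INDUCTION** — `hnest` VERBATIM («`Ū^j(U_k V) ∈ D j` for `V ∈ dom k`, `j < k ≤ K`») from: the bookkeeping sets `D (j+1)`
lie inside the level-`(j+1)` solvable set at radius `θ₀.ν.εreg` (`hDsol`) and are gauge-stable (`hDst`; `hD0st` for `D 0`); the LOCALISED SUPPORT clause
«`χ^{(2.9)}_j(U) = 0` for `Ū U ∈ D (j+1)`, `U ∉ D j`» (`hχD`); [B11]'s one-orbit clause for the backgrounds of the run (`horb`, radii `ε` ∕ `θ₀.ν.εreg`); solvability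
at the top (`hsol`) and the top-field membership `V ∈ D k` (`htop`); the sign `0 < ε₂₉`.  Step `j+1 ↦ j`: `W′ := Ū^{j+1}(U_k V) ∈ D (j+1)` is solvable, so
`χ_j(V^{(j)}(W′)) = 1 ≠ 0` with `Ū(V^{(j)}(W′)) = W′ ∈ D (j+1)`, whence `V^{(j)}(W′) ∈ D j`; and `V^{(j)}(W′) = (Ū^j(U_k V))^{s}` for a level-`j` transformation `s`, so
`Ū^j(U_k V) = (V^{(j)}(W′))^{s⁻¹} ∈ D j`.  NO hereditary selection, NO axiality; `dom`, `D`, `ε` arbitrary.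
[cite: Balaban1987RG1, (2.1)–(2.3) p.265, (2.9)–(2.10) pp.266–267 and (1.1) p.260; Balaban1985Variational, Thm 1 (8)–(10) p.279] -/
theorem iterUk_mem_of_suppLoc_of_stable_of_orbitRel (θ₀ : Stage13Params F N) (hε : 0 < θ₀.ε₂₉) (P : B12.RunParams) {ε : ℝ}
    {dom : (k : ℕ) → Set (GaugeField (F.P P.K) k (SU N))} (D : (j : ℕ) → Set (GaugeField (F.P P.K) j (SU N)))
    (hDsol : ∀ j < P.K, ∀ W ∈ D (j + 1), UkExists F N P.K (j + 1) θ₀.ν.εreg W)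
    (hDst : ∀ j < P.K, ∀ (v : GaugeTransf (F.P P.K) (j + 1) (SU N)) (V : GaugeField (F.P P.K) (j + 1) (SU N)), V ∈ D (j + 1) → gaugeAct v V ∈ D (j + 1))
    (hD0st : ∀ (u : GaugeTransf (F.P P.K) 0 (SU N)) (U : GaugeField (F.P P.K) 0 (SU N)), U ∈ D 0 → gaugeAct u U ∈ D 0)
    (hχD : ∀ j < P.K, ∀ U : GaugeField (F.P P.K) j (SU N), (avOfRecord F N P.K j).avg U ∈ D (j + 1) → U ∉ D j →
      chiβOfRecord₁₃ F N θ₀ P.K (gOfRecord₁₃ F N θ₀ P) j U = 0)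
    (horb : ∀ k, k ≤ P.K → ∀ V ∈ dom k, ∀ j < k, OrbitRel (j + 1) (Uk F N P.K k ε V)
      (Uk F N P.K (j + 1) θ₀.ν.εreg (Averaging.iter (avOfRecord F N P.K) (j + 1) (Uk F N P.K k ε V))))
    (hsol : ∀ k, k ≤ P.K → ∀ V ∈ dom k, UkExists F N P.K k ε V)
    (htop : ∀ k, k ≤ P.K → ∀ V ∈ dom k, V ∈ D k) :
    ∀ k, k ≤ P.K → ∀ V ∈ dom k, ∀ j < k, Averaging.iter (avOfRecord F N P.K) j (Uk F N P.K k ε V) ∈ D j := by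
  -- gauge-stability at every level `j ≤ K` (level `0` from `hD0st`, level `j+1` from `hDst j`)
  have hst : ∀ j, j ≤ P.K → ∀ (v : GaugeTransf (F.P P.K) j (SU N)) (V : GaugeField (F.P P.K) j (SU N)), V ∈ D j → gaugeAct v V ∈ D j := by
    intro j
    cases j with
    | zero => exact fun _ => hD0st
    | succ j => exact fun hj => hDst j (Nat.lt_of_succ_le hj)
  intro k hk V hV
  -- downward induction on the distance `n = k - j` to the top level
  have main : ∀ n j, j + n = k → Averaging.iter (avOfRecord F N P.K) j (Uk F N P.K k ε V) ∈ D j := by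
    intro n
    induction n with
    | zero =>
        intro j hj
        rw [Nat.add_zero] at hj
        subst hj
        rw [iter_Uk (hsol j hk V hV)]
        exact htop j hk V hV
    | succ n ih =>
        intro j hj
        have hjk : j < k := by omega
        have hjK : j < P.K := lt_of_lt_of_le hjk hk
        have IH : Averaging.iter (avOfRecord F N P.K) (j + 1) (Uk F N P.K k ε V) ∈ D (j + 1) := ih (j + 1) (by omega)
        -- the average `W′ := Ū^{j+1}(U_k V)` is solvable, so `χ_j(V^{(j)}(W′)) = 1` and `Ū(V^{(j)}(W′)) = W′ ∈ D (j+1)`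
        have hW : UkExists F N P.K (j + 1) θ₀.ν.εreg (Averaging.iter (avOfRecord F N P.K) (j + 1) (Uk F N P.K k ε V)) :=
          hDsol j hjK _ IH
        have h1 := chiβ13_critCfg_eq_one_of_ukExists θ₀ hε P.K (gOfRecord₁₃ F N θ₀ P) j hW
        have havg : (avOfRecord F N P.K j).avg
            (critCfgOfRecord F N θ₀.ν P.K j (Averaging.iter (avOfRecord F N P.K) (j + 1) (Uk F N P.K k ε V))) ∈ D (j + 1) := by
          rw [avg_critCfgOfRecord hW]
          exact IH
        -- hence the critical configuration lies in `D j` (localised support clause, contrapositive)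
        have hmem : critCfgOfRecord F N θ₀.ν P.K j (Averaging.iter (avOfRecord F N P.K) (j + 1) (Uk F N P.K k ε V)) ∈ D j := by
          by_contra hnot
          have h0 := hχD j hjK _ havg hnot
          rw [h1] at h0
          exact one_ne_zero h0
        -- and it is a level-`j` gauge image of `Ū^j(U_k V)`: transport the membership back
        obtain ⟨u, -, hcrit⟩ := critCfgOfRecord_iter_succ_eq_gaugeAct_of_orbitRel θ₀.ν hjK (horb k hk V hV j hjk)
        rw [hcrit] at hmem
        have hback := hst j hjK.le (invTransf (toMS u j)) _ hmem
        rwa [gaugeAct_inv_gaugeAct] at hback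
  intro j hj
  exact main (k - j) j (by omega)

/-! ## §2. The Theorem-3 member ∕ N09 at the Stage-13 v1.7 construction, dag-n09-w2's localised door, with the nesting binder REPLACED by [B11]'s one-orbit clause
+ the top-field membership + stability of `D 0` + `0 < ε₂₉` -/

/-- ★★ **THE THEOREM-3 MEMBER AT THE STAGE-13 v1.7 CONSTRUCTION, LOCALISED FORM, NESTING BINDER DERIVED**: dag-n09-w2's `thm3Member_stage13SepCoPH_of_stepsOnLoc`
(p591459) with `hnest` supplied by `iterUk_mem_of_suppLoc_of_stable_of_orbitRel` from the door's OWN `hDsol` ∕ `hDst` ∕ `hχD` ∕ `h11` plus: the one-orbit clause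
`horb` for the backgrounds of record (radii `θ.εbg` ∕ `θ.ν.εreg`; [B11] Thm 1 — at one radius the door's `hres` + `huniq`, §3; with two radii dag-n09-w1 g2's
mixed-radii lemma), the top-field membership `htop` («`V ∈ D k` for `V ∈ domAlt_k`»), gauge-stability of `D 0` and `0 < θ.ε₂₉`.  Every other binder VERBATIM:
(181)ˢᵒˡ `hcov`, `hDsol`, `hDo ∕ hDm ∕ hDst`, the localised support clause `hχD`, (I19) `hint`, `hreg`, [B11] ×3 `h11 ∕ hres ∕ huniq` at radius `θ.εbg` on
`domAltOfRecord θ.ν`.  NO hereditary selection, NO axial convention.  CONDITIONAL on every displayed hypothesis; nothing of Bałaban asserted; N09 NOT discharged.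
[cite: Balaban1987RG1, Thm 3 p.264, (1.1)–(1.3) p.260, (0.13) p.254, (2.1)–(2.3) p.265, (2.9)–(2.10) pp.266–267; Balaban1985Variational, Thm 1 (8)–(10) p.279 and (181) p.307] -/
theorem thm3Member_stage13SepCoPH_of_stepsOnLoc_of_orbitRel (θ : Stage13HParams F N) (h : θ.Provisos₁₃SepCoPH F N) {w : WorldP}
    (hC : w.C = (datumOfRecord₁₃SepCoPH F N θ h).C) (P : B12.RunParams) (D : (j : ℕ) → Set (GaugeField (F.P P.K) j (SU N))) (hε : 0 < θ.ε₂₉)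
    (hcov : ∀ j < P.K, ∀ (v : GaugeTransf (F.P P.K) (j + 1) (SU N)) (W : GaugeField (F.P P.K) (j + 1) (SU N)),
      UkExists F N P.K (j + 1) θ.toStage13Params.ν.εreg W →
        critCfgOfRecord F N θ.toStage13Params.ν P.K j (gaugeAct v W) = gaugeAct (liftTransf v) (critCfgOfRecord F N θ.toStage13Params.ν P.K j W))
    (hDsol : ∀ j < P.K, ∀ W ∈ D (j + 1), UkExists F N P.K (j + 1) θ.toStage13Params.ν.εreg W)
    (hDo : ∀ j < P.K, IsOpen (D (j + 1))) (hDm : ∀ j < P.K, MeasurableSet (D (j + 1)))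
    (hDst : ∀ j < P.K, ∀ (v : GaugeTransf (F.P P.K) (j + 1) (SU N)) (V : GaugeField (F.P P.K) (j + 1) (SU N)), V ∈ D (j + 1) → gaugeAct v V ∈ D (j + 1))
    (hD0st : ∀ (u : GaugeTransf (F.P P.K) 0 (SU N)) (U : GaugeField (F.P P.K) 0 (SU N)), U ∈ D 0 → gaugeAct u U ∈ D 0)
    (hχD : ∀ j < P.K, ∀ U : GaugeField (F.P P.K) j (SU N), (avOfRecord F N P.K j).avg U ∈ D (j + 1) → U ∉ D j →
      chiβOfRecord₁₃ F N θ.toStage13Params P.K (gOfRecord₁₃ F N θ.toStage13Params P) j U = 0)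
    (hint : ∀ j < P.K, Integrable (betaInputOfRecord F N (TβOfRecord₁₃ F N) (chiβOfRecord₁₃ F N θ.toStage13Params) P.K (gOfRecord₁₃ F N θ.toStage13Params P) j)
      (fieldMeasure (F.P P.K) j (SU N)))
    (hreg : ∀ j < P.K, D (j + 1) ⊆ regSetOfRecord F N P.K j
      (betaInputOfRecord F N (TβOfRecord₁₃ F N) (chiβOfRecord₁₃ F N θ.toStage13Params) P.K (gOfRecord₁₃ F N θ.toStage13Params P) j))
    (h11 : ∀ k, k ≤ P.K → ∀ V ∈ domAltOfRecord F N θ.ν P.K k, UkExists F N P.K k θ.εbg V ∧ UniqueUkOrbit F N P.K k θ.εbg V)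
    (hres : ∀ k, k ≤ P.K → HRestrict F N θ.εbg P.K k (domAltOfRecord F N θ.ν P.K k))
    (huniq : ∀ k, k ≤ P.K → ∀ V ∈ domAltOfRecord F N θ.ν P.K k, ∀ j < k,
      UniqueUkOrbit F N P.K (j + 1) θ.εbg (Averaging.iter (avOfRecord F N P.K) (j + 1) (Uk F N P.K k θ.εbg V)))
    (horb : ∀ k, k ≤ P.K → ∀ V ∈ domAltOfRecord F N θ.ν P.K k, ∀ j < k, OrbitRel (j + 1) (Uk F N P.K k θ.εbg V)
      (Uk F N P.K (j + 1) θ.toStage13Params.ν.εreg (Averaging.iter (avOfRecord F N P.K) (j + 1) (Uk F N P.K k θ.εbg V))))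
    (htop : ∀ k, k ≤ P.K → ∀ V ∈ domAltOfRecord F N θ.ν P.K k, V ∈ D k) :
    (leavesP w P).smallCouplings → (leavesP w P).smallFieldInductive :=
  thm3Member_stage13SepCoPH_of_stepsOnLoc θ h hC P D hcov hDsol hDo hDm hDst hχD hint hreg h11 hres huniq
    (iterUk_mem_of_suppLoc_of_stable_of_orbitRel θ.toStage13Params hε P D hDsol hDst hD0st hχD horb (fun k hk V hV => (h11 k hk V hV).1) htop)

/-- **N09 AT `(w, P)`, STAGE-13 v1.7 CONSTRUCTION, LOCALISED FORM, NESTING BINDER DERIVED**: its own leaf `b12` ([I] Lemma 4) + the inputs of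
`thm3Member_stage13SepCoPH_of_stepsOnLoc_of_orbitRel` ⇒ `Dag.B12_main (leavesP w P)`.  CONDITIONAL; N09 NOT discharged.
[cite: Balaban1987RG1, Lemma 4 (3.53) p.280, Thm 3 p.264, (1.1)–(1.3) p.260, (2.1)–(2.3) p.265 and (2.9) p.266; Balaban1985Variational, Thm 1 p.279 and (181) p.307] -/
theorem b12_main_stage13SepCoPH_of_leaf_of_stepsOnLoc_of_orbitRel (θ : Stage13HParams F N) (h : θ.Provisos₁₃SepCoPH F N) {w : WorldP}
    (hC : w.C = (datumOfRecord₁₃SepCoPH F N θ h).C) (P : B12.RunParams) (h12 : (leavesP w P).b12) (D : (j : ℕ) → Set (GaugeField (F.P P.K) j (SU N)))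
    (hε : 0 < θ.ε₂₉)
    (hcov : ∀ j < P.K, ∀ (v : GaugeTransf (F.P P.K) (j + 1) (SU N)) (W : GaugeField (F.P P.K) (j + 1) (SU N)),
      UkExists F N P.K (j + 1) θ.toStage13Params.ν.εreg W →
        critCfgOfRecord F N θ.toStage13Params.ν P.K j (gaugeAct v W) = gaugeAct (liftTransf v) (critCfgOfRecord F N θ.toStage13Params.ν P.K j W))
    (hDsol : ∀ j < P.K, ∀ W ∈ D (j + 1), UkExists F N P.K (j + 1) θ.toStage13Params.ν.εreg W)
    (hDo : ∀ j < P.K, IsOpen (D (j + 1))) (hDm : ∀ j < P.K, MeasurableSet (D (j + 1)))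
    (hDst : ∀ j < P.K, ∀ (v : GaugeTransf (F.P P.K) (j + 1) (SU N)) (V : GaugeField (F.P P.K) (j + 1) (SU N)), V ∈ D (j + 1) → gaugeAct v V ∈ D (j + 1))
    (hD0st : ∀ (u : GaugeTransf (F.P P.K) 0 (SU N)) (U : GaugeField (F.P P.K) 0 (SU N)), U ∈ D 0 → gaugeAct u U ∈ D 0)
    (hχD : ∀ j < P.K, ∀ U : GaugeField (F.P P.K) j (SU N), (avOfRecord F N P.K j).avg U ∈ D (j + 1) → U ∉ D j →
      chiβOfRecord₁₃ F N θ.toStage13Params P.K (gOfRecord₁₃ F N θ.toStage13Params P) j U = 0)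
    (hint : ∀ j < P.K, Integrable (betaInputOfRecord F N (TβOfRecord₁₃ F N) (chiβOfRecord₁₃ F N θ.toStage13Params) P.K (gOfRecord₁₃ F N θ.toStage13Params P) j)
      (fieldMeasure (F.P P.K) j (SU N)))
    (hreg : ∀ j < P.K, D (j + 1) ⊆ regSetOfRecord F N P.K j
      (betaInputOfRecord F N (TβOfRecord₁₃ F N) (chiβOfRecord₁₃ F N θ.toStage13Params) P.K (gOfRecord₁₃ F N θ.toStage13Params P) j))
    (h11 : ∀ k, k ≤ P.K → ∀ V ∈ domAltOfRecord F N θ.ν P.K k, UkExists F N P.K k θ.εbg V ∧ UniqueUkOrbit F N P.K k θ.εbg V)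
    (hres : ∀ k, k ≤ P.K → HRestrict F N θ.εbg P.K k (domAltOfRecord F N θ.ν P.K k))
    (huniq : ∀ k, k ≤ P.K → ∀ V ∈ domAltOfRecord F N θ.ν P.K k, ∀ j < k,
      UniqueUkOrbit F N P.K (j + 1) θ.εbg (Averaging.iter (avOfRecord F N P.K) (j + 1) (Uk F N P.K k θ.εbg V)))
    (horb : ∀ k, k ≤ P.K → ∀ V ∈ domAltOfRecord F N θ.ν P.K k, ∀ j < k, OrbitRel (j + 1) (Uk F N P.K k θ.εbg V)
      (Uk F N P.K (j + 1) θ.toStage13Params.ν.εreg (Averaging.iter (avOfRecord F N P.K) (j + 1) (Uk F N P.K k θ.εbg V))))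
    (htop : ∀ k, k ≤ P.K → ∀ V ∈ domAltOfRecord F N θ.ν P.K k, V ∈ D k) :
    Dag.B12_main (leavesP w P) :=
  b12_main_of_leaf_of_thm3Member h12
    (thm3Member_stage13SepCoPH_of_stepsOnLoc_of_orbitRel θ h hC P D hε hcov hDsol hDo hDm hDst hD0st hχD hint hreg h11 hres huniq horb htop)

/-- **THE `∀ P` FORM = N24's DISPLAYED BINDER `h09T` AT A WORLD BOUND TO THE STAGE-13 v1.7 CONSTRUCTION, NESTING BINDER DERIVED** (the shape dag-n24-c's 24H
`…SignFreeAllTorusN09Loc` consumes run by run with its bookkeeping sets `D09 P`; its `h09nest` is now supplied from its `h09supp` ∕ `h09Dst` ∕ `h09Dsol` ∕ `h07sol` + the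
one-orbit clause + the top-field membership + stability of `D09 P 0` + its `hε'`).  CONDITIONAL; N09 NOT discharged; K1⁷ NOT closed.
[cite: Balaban1987RG1, Thm 3 p.264, (1.1)–(1.3) p.260, (2.1)–(2.3) p.265, (2.9)–(2.10) pp.266–267; Balaban1985Variational, Thm 1 (8)–(10) p.279 and (181) p.307] -/
theorem thm3Member_forall_stage13SepCoPH_of_stepsOnLoc_of_orbitRel (θ : Stage13HParams F N) (h : θ.Provisos₁₃SepCoPH F N) {w : WorldP}
    (hC : w.C = (datumOfRecord₁₃SepCoPH F N θ h).C) (D : (P : B12.RunParams) → (j : ℕ) → Set (GaugeField (F.P P.K) j (SU N))) (hε : 0 < θ.ε₂₉)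
    (hcov : ∀ (P : B12.RunParams), ∀ j < P.K, ∀ (v : GaugeTransf (F.P P.K) (j + 1) (SU N)) (W : GaugeField (F.P P.K) (j + 1) (SU N)),
      UkExists F N P.K (j + 1) θ.toStage13Params.ν.εreg W →
        critCfgOfRecord F N θ.toStage13Params.ν P.K j (gaugeAct v W) = gaugeAct (liftTransf v) (critCfgOfRecord F N θ.toStage13Params.ν P.K j W))
    (hDsol : ∀ (P : B12.RunParams), ∀ j < P.K, ∀ W ∈ D P (j + 1), UkExists F N P.K (j + 1) θ.toStage13Params.ν.εreg W)
    (hDo : ∀ (P : B12.RunParams), ∀ j < P.K, IsOpen (D P (j + 1))) (hDm : ∀ (P : B12.RunParams), ∀ j < P.K, MeasurableSet (D P (j + 1)))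
    (hDst : ∀ (P : B12.RunParams), ∀ j < P.K, ∀ (v : GaugeTransf (F.P P.K) (j + 1) (SU N)) (V : GaugeField (F.P P.K) (j + 1) (SU N)),
      V ∈ D P (j + 1) → gaugeAct v V ∈ D P (j + 1))
    (hD0st : ∀ (P : B12.RunParams) (u : GaugeTransf (F.P P.K) 0 (SU N)) (U : GaugeField (F.P P.K) 0 (SU N)), U ∈ D P 0 → gaugeAct u U ∈ D P 0)
    (hχD : ∀ (P : B12.RunParams), ∀ j < P.K, ∀ U : GaugeField (F.P P.K) j (SU N), (avOfRecord F N P.K j).avg U ∈ D P (j + 1) → U ∉ D P j →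
      chiβOfRecord₁₃ F N θ.toStage13Params P.K (gOfRecord₁₃ F N θ.toStage13Params P) j U = 0)
    (hint : ∀ (P : B12.RunParams), ∀ j < P.K, Integrable (betaInputOfRecord F N (TβOfRecord₁₃ F N) (chiβOfRecord₁₃ F N θ.toStage13Params) P.K
      (gOfRecord₁₃ F N θ.toStage13Params P) j) (fieldMeasure (F.P P.K) j (SU N)))
    (hreg : ∀ (P : B12.RunParams), ∀ j < P.K, D P (j + 1) ⊆ regSetOfRecord F N P.K j
      (betaInputOfRecord F N (TβOfRecord₁₃ F N) (chiβOfRecord₁₃ F N θ.toStage13Params) P.K (gOfRecord₁₃ F N θ.toStage13Params P) j))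
    (h11 : ∀ (P : B12.RunParams) (k : ℕ), k ≤ P.K → ∀ V ∈ domAltOfRecord F N θ.ν P.K k, UkExists F N P.K k θ.εbg V ∧ UniqueUkOrbit F N P.K k θ.εbg V)
    (hres : ∀ (P : B12.RunParams) (k : ℕ), k ≤ P.K → HRestrict F N θ.εbg P.K k (domAltOfRecord F N θ.ν P.K k))
    (huniq : ∀ (P : B12.RunParams) (k : ℕ), k ≤ P.K → ∀ V ∈ domAltOfRecord F N θ.ν P.K k, ∀ j < k,
      UniqueUkOrbit F N P.K (j + 1) θ.εbg (Averaging.iter (avOfRecord F N P.K) (j + 1) (Uk F N P.K k θ.εbg V)))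
    (horb : ∀ (P : B12.RunParams) (k : ℕ), k ≤ P.K → ∀ V ∈ domAltOfRecord F N θ.ν P.K k, ∀ j < k, OrbitRel (j + 1) (Uk F N P.K k θ.εbg V)
      (Uk F N P.K (j + 1) θ.toStage13Params.ν.εreg (Averaging.iter (avOfRecord F N P.K) (j + 1) (Uk F N P.K k θ.εbg V))))
    (htop : ∀ (P : B12.RunParams) (k : ℕ), k ≤ P.K → ∀ V ∈ domAltOfRecord F N θ.ν P.K k, V ∈ D P k) :
    ∀ P : B12.RunParams, (leavesP w P).smallCouplings → (leavesP w P).smallFieldInductive :=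
  fun P => thm3Member_stage13SepCoPH_of_stepsOnLoc_of_orbitRel θ h hC P (D P) hε (hcov P) (hDsol P) (hDo P) (hDm P) (hDst P) (hD0st P) (hχD P)
    (hint P) (hreg P) (h11 P) (hres P) (huniq P) (horb P) (htop P)

/-! ## §3. The one-radius supplier of the one-orbit clause, and the door at a record with ONE radius -/

/-- **THE ONE-ORBIT CLAUSE AT ONE RADIUS IS THE DOOR'S OWN `hres` + `huniq`**: when the cut-off's radius and the background's radius coincide
(`θ.ν.εreg = θ.εbg` — print has ONE radius `ε₀`, [B11] Thm 1 p. 279), `horb` is node00-def-B's `hOrbit_of_hRestrict_of_unique` ([I] (1.1) «exactly one … orbit»: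
`U_k V` restricts to a level-`(j+1)` minimiser over its own average and the minimal orbit there is unique).  With the two radii of record (`εreg = a₀ ≠ εbg = 1` at
the V18 witness) the supplier is dag-n09-w1 g2's mixed-radii lemma (`…N09HeredModFineOfThm1` §1), cited, not restated.
[cite: Balaban1987RG1, (1.1) p.260; Balaban1985Variational, Thm 1 (8)–(10) p.279] -/
theorem horb_of_hRestrict_of_unique_of_εreg_eq (θ : Stage13HParams F N) (P : B12.RunParams) (heq : θ.toStage13Params.ν.εreg = θ.εbg)
    (hres : ∀ k, k ≤ P.K → HRestrict F N θ.εbg P.K k (domAltOfRecord F N θ.ν P.K k))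
    (huniq : ∀ k, k ≤ P.K → ∀ V ∈ domAltOfRecord F N θ.ν P.K k, ∀ j < k,
      UniqueUkOrbit F N P.K (j + 1) θ.εbg (Averaging.iter (avOfRecord F N P.K) (j + 1) (Uk F N P.K k θ.εbg V))) :
    ∀ k, k ≤ P.K → ∀ V ∈ domAltOfRecord F N θ.ν P.K k, ∀ j < k, OrbitRel (j + 1) (Uk F N P.K k θ.εbg V)
      (Uk F N P.K (j + 1) θ.toStage13Params.ν.εreg (Averaging.iter (avOfRecord F N P.K) (j + 1) (Uk F N P.K k θ.εbg V))) := by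
  intro k hk V hV j hj
  rw [heq]
  exact hOrbit_of_hRestrict_of_unique F N (hres k hk) (huniq k hk) V hV j hj

/-- ★★ **THE LOCALISED DOOR AT A RECORD WITH ONE RADIUS, NESTING BINDER GONE AT NO [B11] COST**: when `θ.ν.εreg = θ.εbg`, dag-n09-w2's
`thm3Member_stage13SepCoPH_of_stepsOnLoc` with `hnest` REPLACED by the top-field membership `htop`, gauge-stability of `D 0` and `0 < θ.ε₂₉` ONLY — the one-orbit
clause is the door's own `hres` + `huniq` (§3 `horb_of_hRestrict_of_unique_of_εreg_eq`).  CONDITIONAL; nothing of Bałaban asserted; N09 NOT discharged.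
[cite: Balaban1987RG1, Thm 3 p.264, (1.1)–(1.3) p.260, (2.1)–(2.3) p.265, (2.9)–(2.10) pp.266–267; Balaban1985Variational, Thm 1 (8)–(10) p.279 and (181) p.307] -/
theorem thm3Member_stage13SepCoPH_of_stepsOnLoc_of_εreg_eq (θ : Stage13HParams F N) (h : θ.Provisos₁₃SepCoPH F N) {w : WorldP}
    (hC : w.C = (datumOfRecord₁₃SepCoPH F N θ h).C) (P : B12.RunParams) (D : (j : ℕ) → Set (GaugeField (F.P P.K) j (SU N))) (hε : 0 < θ.ε₂₉)
    (heq : θ.toStage13Params.ν.εreg = θ.εbg)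
    (hcov : ∀ j < P.K, ∀ (v : GaugeTransf (F.P P.K) (j + 1) (SU N)) (W : GaugeField (F.P P.K) (j + 1) (SU N)),
      UkExists F N P.K (j + 1) θ.toStage13Params.ν.εreg W →
        critCfgOfRecord F N θ.toStage13Params.ν P.K j (gaugeAct v W) = gaugeAct (liftTransf v) (critCfgOfRecord F N θ.toStage13Params.ν P.K j W))
    (hDsol : ∀ j < P.K, ∀ W ∈ D (j + 1), UkExists F N P.K (j + 1) θ.toStage13Params.ν.εreg W)
    (hDo : ∀ j < P.K, IsOpen (D (j + 1))) (hDm : ∀ j < P.K, MeasurableSet (D (j + 1)))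
    (hDst : ∀ j < P.K, ∀ (v : GaugeTransf (F.P P.K) (j + 1) (SU N)) (V : GaugeField (F.P P.K) (j + 1) (SU N)), V ∈ D (j + 1) → gaugeAct v V ∈ D (j + 1))
    (hD0st : ∀ (u : GaugeTransf (F.P P.K) 0 (SU N)) (U : GaugeField (F.P P.K) 0 (SU N)), U ∈ D 0 → gaugeAct u U ∈ D 0)
    (hχD : ∀ j < P.K, ∀ U : GaugeField (F.P P.K) j (SU N), (avOfRecord F N P.K j).avg U ∈ D (j + 1) → U ∉ D j →
      chiβOfRecord₁₃ F N θ.toStage13Params P.K (gOfRecord₁₃ F N θ.toStage13Params P) j U = 0)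
    (hint : ∀ j < P.K, Integrable (betaInputOfRecord F N (TβOfRecord₁₃ F N) (chiβOfRecord₁₃ F N θ.toStage13Params) P.K (gOfRecord₁₃ F N θ.toStage13Params P) j)
      (fieldMeasure (F.P P.K) j (SU N)))
    (hreg : ∀ j < P.K, D (j + 1) ⊆ regSetOfRecord F N P.K j
      (betaInputOfRecord F N (TβOfRecord₁₃ F N) (chiβOfRecord₁₃ F N θ.toStage13Params) P.K (gOfRecord₁₃ F N θ.toStage13Params P) j))
    (h11 : ∀ k, k ≤ P.K → ∀ V ∈ domAltOfRecord F N θ.ν P.K k, UkExists F N P.K k θ.εbg V ∧ UniqueUkOrbit F N P.K k θ.εbg V)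
    (hres : ∀ k, k ≤ P.K → HRestrict F N θ.εbg P.K k (domAltOfRecord F N θ.ν P.K k))
    (huniq : ∀ k, k ≤ P.K → ∀ V ∈ domAltOfRecord F N θ.ν P.K k, ∀ j < k,
      UniqueUkOrbit F N P.K (j + 1) θ.εbg (Averaging.iter (avOfRecord F N P.K) (j + 1) (Uk F N P.K k θ.εbg V)))
    (htop : ∀ k, k ≤ P.K → ∀ V ∈ domAltOfRecord F N θ.ν P.K k, V ∈ D k) :
    (leavesP w P).smallCouplings → (leavesP w P).smallFieldInductive :=
  thm3Member_stage13SepCoPH_of_stepsOnLoc_of_orbitRel θ h hC P D hε hcov hDsol hDo hDm hDst hD0st hχD hint hreg h11 hres huniq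
    (horb_of_hRestrict_of_unique_of_εreg_eq θ P heq hres huniq) htop

/-- **N09 AT `(w, P)` AT A RECORD WITH ONE RADIUS, NESTING BINDER GONE AT NO [B11] COST**: own leaf `b12` + the inputs of
`thm3Member_stage13SepCoPH_of_stepsOnLoc_of_εreg_eq` ⇒ `Dag.B12_main (leavesP w P)`.  CONDITIONAL; N09 NOT discharged.
[cite: Balaban1987RG1, Lemma 4 (3.53) p.280, Thm 3 p.264, (1.1)–(1.3) p.260, (2.1)–(2.3) p.265 and (2.9) p.266; Balaban1985Variational, Thm 1 p.279 and (181) p.307] -/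
theorem b12_main_stage13SepCoPH_of_leaf_of_stepsOnLoc_of_εreg_eq (θ : Stage13HParams F N) (h : θ.Provisos₁₃SepCoPH F N) {w : WorldP}
    (hC : w.C = (datumOfRecord₁₃SepCoPH F N θ h).C) (P : B12.RunParams) (h12 : (leavesP w P).b12) (D : (j : ℕ) → Set (GaugeField (F.P P.K) j (SU N)))
    (hε : 0 < θ.ε₂₉) (heq : θ.toStage13Params.ν.εreg = θ.εbg)
    (hcov : ∀ j < P.K, ∀ (v : GaugeTransf (F.P P.K) (j + 1) (SU N)) (W : GaugeField (F.P P.K) (j + 1) (SU N)),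
      UkExists F N P.K (j + 1) θ.toStage13Params.ν.εreg W →
        critCfgOfRecord F N θ.toStage13Params.ν P.K j (gaugeAct v W) = gaugeAct (liftTransf v) (critCfgOfRecord F N θ.toStage13Params.ν P.K j W))
    (hDsol : ∀ j < P.K, ∀ W ∈ D (j + 1), UkExists F N P.K (j + 1) θ.toStage13Params.ν.εreg W)
    (hDo : ∀ j < P.K, IsOpen (D (j + 1))) (hDm : ∀ j < P.K, MeasurableSet (D (j + 1)))
    (hDst : ∀ j < P.K, ∀ (v : GaugeTransf (F.P P.K) (j + 1) (SU N)) (V : GaugeField (F.P P.K) (j + 1) (SU N)), V ∈ D (j + 1) → gaugeAct v V ∈ D (j + 1))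
    (hD0st : ∀ (u : GaugeTransf (F.P P.K) 0 (SU N)) (U : GaugeField (F.P P.K) 0 (SU N)), U ∈ D 0 → gaugeAct u U ∈ D 0)
    (hχD : ∀ j < P.K, ∀ U : GaugeField (F.P P.K) j (SU N), (avOfRecord F N P.K j).avg U ∈ D (j + 1) → U ∉ D j →
      chiβOfRecord₁₃ F N θ.toStage13Params P.K (gOfRecord₁₃ F N θ.toStage13Params P) j U = 0)
    (hint : ∀ j < P.K, Integrable (betaInputOfRecord F N (TβOfRecord₁₃ F N) (chiβOfRecord₁₃ F N θ.toStage13Params) P.K (gOfRecord₁₃ F N θ.toStage13Params P) j)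
      (fieldMeasure (F.P P.K) j (SU N)))
    (hreg : ∀ j < P.K, D (j + 1) ⊆ regSetOfRecord F N P.K j
      (betaInputOfRecord F N (TβOfRecord₁₃ F N) (chiβOfRecord₁₃ F N θ.toStage13Params) P.K (gOfRecord₁₃ F N θ.toStage13Params P) j))
    (h11 : ∀ k, k ≤ P.K → ∀ V ∈ domAltOfRecord F N θ.ν P.K k, UkExists F N P.K k θ.εbg V ∧ UniqueUkOrbit F N P.K k θ.εbg V)
    (hres : ∀ k, k ≤ P.K → HRestrict F N θ.εbg P.K k (domAltOfRecord F N θ.ν P.K k))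
    (huniq : ∀ k, k ≤ P.K → ∀ V ∈ domAltOfRecord F N θ.ν P.K k, ∀ j < k,
      UniqueUkOrbit F N P.K (j + 1) θ.εbg (Averaging.iter (avOfRecord F N P.K) (j + 1) (Uk F N P.K k θ.εbg V)))
    (htop : ∀ k, k ≤ P.K → ∀ V ∈ domAltOfRecord F N θ.ν P.K k, V ∈ D k) :
    Dag.B12_main (leavesP w P) :=
  b12_main_of_leaf_of_thm3Member h12
    (thm3Member_stage13SepCoPH_of_stepsOnLoc_of_εreg_eq θ h hC P D hε heq hcov hDsol hDo hDm hDst hD0st hχD hint hreg h11 hres huniq htop)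

end Summit.QuantumFields.YangMills.BalabanUVNodes.N09NestingFromSupport

end
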